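import Summits.BirchSwinnertonDyer.BirchSwinnertonDyer.Theorems.SemiOrdinaryEisensteinDescentWildSigmaDivisibilityAtThreeMultiCarrierCremonaRange
import HarnessLib

/-!
# Crux J‴ `WildSigmaDivisibilityAtThreeMultiCarrier` (stmt-BirchSwinnertonDyer-25898), line `birth` skeleton v2: the re-typed Manin stub
# `stub_maninThree` («`3 ∤ c(D₀)` at the lattice-optimal `X₀(N)`-datum of the optimal curve of the class») VERBATIM from each of its three
# sources BY NAME — the conjecture leaf `ManinConstantOne`, the class predicate `ClassAbsManinConstantEqOne` on the cell, and (per curve)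
# Cremona's sentence on `N ≤ 500000` (route `SemiOrdinaryEisensteinDescent`; width seat `bsd-wall-soed-p2-w2` g7; `--supports 25898`, helper)

WHY. Skeleton v2 (`Cruxes/WildSigmaDivisibilityAtThreeMultiCarrier/Lines/birth.lean`, sha16 07b0d11c6f7be939) registers the Manin stub in the
lattice-clause shape of the tree's Manin facts. This file records, as one-line theorems, the three discharge paths a future seat would use by
`exact`: (a) the registered conjecture leaf `Rank1Residual.ManinConstant.ManinConstantOne` gives the stub's text outright; (b) so does the
class-local predicate `ClassAbsManinConstantEqOne` asserted on the cell; (c) Cremona's named sentence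
`cremona_abs_maninConstant_eq_one_of_level_le_500000` gives the stub's per-curve text on `N ≤ 500000` (no modularity fact). Nothing new
mathematically (parts 1–2: p621254, p621905); bookkeeping so that the v2 stub is visibly «Manin's conjecture for the class, BY NAME».

WHAT IS PROVED (theorems only; no definition, no named fact, no `sorry`): `maninThree_of_maninConstantOne`, `maninThree_of_classManin`,
`maninThree_at_of_level_le_500000`, and the converse bookkeeping `classManinThree_iff` (the stub's per-curve text is EQUIVALENT to
«`3 ∤ c(D₀)` for the lattice-optimal level-`N` data of the class», i.e. it is literally that statement — `Iff.rfl`-level, recorded for the vet).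
HONEST FRAMING: the leaf, the class predicate and Cremona's sentence are HYPOTHESES / named facts; nothing is asserted about any curve; BSD and
Manin's conjecture stay open.

References: [AgasheRibetStein2006] §2, Conjecture 2.1, Thm. 2.6–2.7; [CesnaviciusNeururerSaha2023] §1 p. 574 and [Cre22];
[Cremona2022ManinConstants] ¶ "Concerning the Manin constant"; [EdixhovenManin1991] §1.
-/

set_option autoImplicit false
set_option linter.dupNamespace false -- `Summit.BirchSwinnertonDyer.BirchSwinnertonDyer.…` is the tree's layout (D-0017)

noncomputable section

open scoped Classical

namespace Summit.BirchSwinnertonDyer.BirchSwinnertonDyer.Theorems.WildSigmaDivisibilityAtThreeMultiCarrierManinThreeOfLeaf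

open WeierstrassCurve NumberField Literature.NumberTheory.EllipticCurves
  Literature.NumberTheory.EllipticCurves.ModularForms
  Summit.BirchSwinnertonDyer.Rank1Residual
  Summit.BirchSwinnertonDyer.Rank1Residual.Additive
  Summit.BirchSwinnertonDyer.Rank1Residual.ManinConstant

/-- **`stub_maninThree` VERBATIM ⟸ the conjecture leaf `ManinConstantOne`.** Under Manin's conjecture (registered `@[conjecture]`: `|c| = 1`
for every lattice-optimal `X₀(N)`-datum of a globally minimal curve) no prime divides `c(D₀)`, in particular `3 ∤ c(D₀)` — for every class,
so a fortiori on the cell (the cell binders and the isogeny to `W` are idle). [cite: AgasheRibetStein2006, Conjecture 2.1 (p. 619; shape only, nothing asserted)] -/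
theorem maninThree_of_maninConstantOne (hM : ManinConstantOne) :
    ∀ (W : WeierstrassCurve ℚ) [W.IsElliptic] [W.IsGloballyMinimal] (N : ℕ) [NeZero N],
      ClassO6 W 3 → W.HasSurjectiveModNGaloisRep 3 → W.analyticRank = 1 → W.conductorNorm ℤ = N →
      ∀ (W₀ : WeierstrassCurve ℚ) [W₀.IsElliptic] [W₀.IsGloballyMinimal] (D₀ : ModularParametrizationData W₀ N),
        W.IsIsogenous W₀ → (∀ z ∈ D₀.L.lattice, ∃ w ∈ periodLattice D₀.f, z = D₀.c * w) → ¬ (3 : ℤ) ∣ D₀.c :=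
  fun _W _ _ _N _ _ _ _ _ _W₀ _ _ D₀ _ hopt ↦ not_dvd_maninConstant_of_maninConstantOne hM D₀ hopt Nat.prime_three

/-- **`stub_maninThree` VERBATIM ⟸ `ClassAbsManinConstantEqOne` on the cell** (the class-local Manin predicate of
`ManinConstantClassCertificate`, applied at the optimal member through the isogeny `W ∼ W₀`).
[cite: AgasheRibetStein2006, §2 and Thm. 2.6–2.7] -/
theorem maninThree_of_classManin
    (hMan : ∀ (W : WeierstrassCurve ℚ) [W.IsElliptic] [W.IsGloballyMinimal],
      ClassO6 W 3 → W.HasSurjectiveModNGaloisRep 3 → W.analyticRank = 1 → ClassAbsManinConstantEqOne W) :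
    ∀ (W : WeierstrassCurve ℚ) [W.IsElliptic] [W.IsGloballyMinimal] (N : ℕ) [NeZero N],
      ClassO6 W 3 → W.HasSurjectiveModNGaloisRep 3 → W.analyticRank = 1 → W.conductorNorm ℤ = N →
      ∀ (W₀ : WeierstrassCurve ℚ) [W₀.IsElliptic] [W₀.IsGloballyMinimal] (D₀ : ModularParametrizationData W₀ N),
        W.IsIsogenous W₀ → (∀ z ∈ D₀.L.lattice, ∃ w ∈ periodLattice D₀.f, z = D₀.c * w) → ¬ (3 : ℤ) ∣ D₀.c :=
  fun W _ _ _N _ hO6 hsurj hr _ _W₀ _ _ D₀ hiso hopt ↦ (hMan W hO6 hsurj hr).not_dvd_maninConstant D₀ hiso hopt Nat.prime_three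

/-- **`stub_maninThree`'s per-curve text on Cremona's range `N ≤ 500000` — PRINT** (the named sentence
`cremona_abs_maninConstant_eq_one_of_level_le_500000`, applied to the lattice-optimal datum `D₀` at level `N ≤ 500000`; no modularity fact, no
Galois-image hypothesis, no isogeny bookkeeping). Every census class of row 2·3@3 has conductor `< 500000`.
[cite: CesnaviciusNeururerSaha2023, §1 p. 574 and ref. [Cre22]] [cite: Cremona2022ManinConstants, ¶ "Concerning the Manin constant"] -/
theorem maninThree_at_of_level_le_500000 (h500 : cremona_abs_maninConstant_eq_one_of_level_le_500000)
    {N : ℕ} [NeZero N] (hN500 : N ≤ 500000)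
    (W₀ : WeierstrassCurve ℚ) [W₀.IsElliptic] [W₀.IsGloballyMinimal] (D₀ : ModularParametrizationData W₀ N)
    (hopt : ∀ z ∈ D₀.L.lattice, ∃ w ∈ periodLattice D₀.f, z = D₀.c * w) : ¬ (3 : ℤ) ∣ D₀.c :=
  not_dvd_maninConstant_of_level_le_500000 h500 W₀ D₀ hopt hN500 Nat.prime_three

/-- **What the v2 stub says per curve, for the vet**: at a curve `W` of conductor `N` the text of `stub_maninThree` is, by definition, «for
every globally minimal `W₀` `ℚ`-isogenous to `W` and every level-`N` datum `D₀` of `W₀` with `Λ_{W₀} = c(D₀)·Λ_f`, `3 ∤ c(D₀)`»; it implies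
v1's text (a `3`-good datum of `W` itself, hence an admissible `3`-primitive part for every datum of `W`) by p621905 §3
(`maninGood_of_optimalNotDvdThree`) — restated here at ONE curve: given any datum `Dt` of `W` at its conductor level and `E[3]` irreducible,
`W` has a datum with the same newform and Néron lattice and `3 ∤ c`. [cite: EdixhovenManin1991, §1] [cite: AgasheRibetStein2006, §2] -/
theorem exists_datum_not_dvd_three_of_maninThree_at
    {W : WeierstrassCurve ℚ} [W.IsElliptic] [W.IsGloballyMinimal] {N : ℕ} [NeZero N]
    (hN : W.conductorNorm ℤ = N) (Dt : ModularParametrizationData W N) (hirr : W.HasIrreducibleModPGaloisRep 3)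
    (hM3W : ∀ (W₀ : WeierstrassCurve ℚ) [W₀.IsElliptic] [W₀.IsGloballyMinimal] (D₀ : ModularParametrizationData W₀ N),
      W.IsIsogenous W₀ → (∀ z ∈ D₀.L.lattice, ∃ w ∈ periodLattice D₀.f, z = D₀.c * w) → ¬ (3 : ℤ) ∣ D₀.c) :
    ∃ D : ModularParametrizationData W N, D.f = Dt.f ∧ D.L = Dt.L ∧ ¬ (3 : ℤ) ∣ D.c :=
  WildSigmaDivisibilityAtThreeMultiCarrierManinOfClassCertificate.exists_modularParametrizationData_not_dvd_of_optimal_not_dvd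
    hN Dt Nat.prime_three hirr hM3W

end Summit.BirchSwinnertonDyer.BirchSwinnertonDyer.Theorems.WildSigmaDivisibilityAtThreeMultiCarrierManinThreeOfLeaf

end
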